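import Summits.QuantumFields.YangMills.Theorems.AlphaInputsT3ACv3DataSchemaXChi
import Summits.QuantumFields.YangMills.Theorems.AlphaInputsT3ACv3RecordFL
import HarnessLib

/-!
# `AlphaInputsT3ACv3RecordXChi` — THE χ-TWINS OF THE SEAM-BLIND RECORD-PARAMETRIC DISPLAYS OF 2′ (X4 `…v3CoreNonemptyX` §§2–3 and `…v3RecordFL` §2):
# **`AlphaInputsT3AC.PinnedPartsT3ACRecXChi L`** ((D6X-CHARGED) row) and **`AlphaInputsT3AC.PinnedPartsT3ACRecFLChi L`** ((FL) row), and the successor stub 2′χ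
# `AlphaInputsT3ACv3RecChi L` FROM EACH — R-57χ NAME-MAP port «X-display ↦ …Chi» (OWNER DEPMAP v3.3 OF RECORD 2026-08-27T22:38Z) — cell `ym3-torus`, width seat
# `ym-ust-19936-w2` (g0)

WHY (route `UnitScaleTilt`, crux `HistoryTailL` = stmt-QuantumFields-19936; v5p9's ONE stub 2′χ `stub_laneRecordsV3chi : ∀ L, Odd L → 1 < L → AlphaInputsT3ACv3RecChi L`,
consumed by the landed χ-cone `HistoryTailLaneTailChi.historyTailL_of_laneRecordsChi`; the same token is 20520's v5kC 2′χ).  DEPMAP v3.3 displays the ONE W-dependent kinematic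
row of 2′ as (FL) `InnerFineLiftsT3 … B₃` (alpha-2's `…v3InnerLiftFine` ∕ `…v3RecordFL`: (FL) ⇒ (EL) ⇒ (D6X-CHARGED) under the record sizes, (OP) ⇐ collar and (R3P) DISCHARGED);
this file writes the two seam-blind displays IN χ-CURRENCY — X4's `PinnedPartsT3ACRecX` and `…v3RecordFL`'s `PinnedPartsT3ACRecFL` VERBATIM with the data row
`DataRowsT3X ↦ DataRowsT3XChi` (sibling `…v3DataSchemaXChi`) — and derives the χ-socket from each.  Every record-independent ingredient is REUSED BY NAME: (D6X-CHARGED)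
`AdaptedClassNonemptyChargedT3X`, `adaptedClassNonemptyT3X_of_charged_of_collar`, `collarE_T3_of_M₁_ge`, `four_pi_le_C68_of_sizes`, (FL) `InnerFineLiftsT3`,
`adaptedClassNonemptyChargedT3X_of_fineLifts_of_sizes` ∕ `chargedX_of_fineLifts_cast`, (T) `Thm1GlobalMinAt`, (D5) `TrivMinimiserRowsT3`, `MinimiserPin.anti_of_C68` ∕
`small_of_C68` ∕ `C68_dom_of_le` ∕ `windowIneqT3_of_le`; the constants shell of both displays (rows `hA3`, `hA2`, `1 ≤ 2B₃`, three `C68`-rows, `7L + 3 ≤ M₁`) is alpha-1's theorem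
`pinnedPartsT3ACRecR_shell` (same row list), so ALL displayed content of 2′χ here = (T) + (FL) [resp. (D6X-CHARGED)] + (O″χ) the χ data rows over `𝒞_X`.
* §1 knits: ★★ `ofV3ChiAt_of_pinnedRowsXCChi` ((D6X-CHARGED) + `7L + 3 ≤ M₁`), `dataSchemaT3ACXChi_of_pinnedRows₂C` ∕ ★★ `ofV3ChiAt_of_pinnedRows₂XCChi` (closed-form sizes + (O″χ)).
* §2 ★ `AlphaInputsT3AC.PinnedPartsT3ACRecXChi L` (NAME MAP `PinnedPartsT3ACRecX ↦ PinnedPartsT3ACRecXChi`), `ofV3ChiAt_of_pinnedPartsXChi_cast`, ★★★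
  `alphaInputsT3ACv3RecChi_of_pinnedPartsRecXChi : PinnedPartsT3ACRecXChi L → AlphaInputsT3ACv3RecChi L`.
* §3 ★ `AlphaInputsT3AC.PinnedPartsT3ACRecFLChi L` (NAME MAP `PinnedPartsT3ACRecFL ↦ PinnedPartsT3ACRecFLChi`), `pinnedPartsT3ACRecXChi_of_recFLChi`, ★★★
  `alphaInputsT3ACv3RecChi_of_pinnedPartsRecFLChi : PinnedPartsT3ACRecFLChi L → AlphaInputsT3ACv3RecChi L` — 2′χ BY NAME from (T) + record sizes + (FL) + (O″χ).
NAME MAP additions (R57chi README «TO COME», X-lineage): `ofV3At_of_pinnedRowsXC ∕ ₂XC ↦ ofV3ChiAt_of_pinnedRowsXCChi ∕ ₂XCChi` ; `dataSchemaT3ACX_of_pinnedRows₂C ↦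
dataSchemaT3ACXChi_of_pinnedRows₂C` ; `PinnedPartsT3ACRecX ↦ PinnedPartsT3ACRecXChi` ; `ofV3At_of_pinnedPartsX_cast ↦ ofV3ChiAt_of_pinnedPartsXChi_cast` ;
`alphaInputsT3ACv3Rec_of_pinnedPartsRecX ↦ alphaInputsT3ACv3RecChi_of_pinnedPartsRecXChi` ; `PinnedPartsT3ACRecFL ↦ PinnedPartsT3ACRecFLChi` ; `pinnedPartsT3ACRecX_of_recFL ↦
pinnedPartsT3ACRecXChi_of_recFLChi` ; `alphaInputsT3ACv3Rec_of_pinnedPartsRecFL ↦ alphaInputsT3ACv3RecChi_of_pinnedPartsRecFLChi`.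
HONEST FRAMING.  (T), (D6X-CHARGED) ∕ (FL) and (O″χ) stay DISPLAYED (hypothesis schemas, OPEN, never asserted); the theorems are bookkeeping ∕ transport; nothing of the cluster
expansion ([Balaban1985UV3] §§2–3), of [Balaban1985Variational] Thm 1 or of [Balaban1985Averaging] is proved beyond the tree's [B7] Props. 1–2.  Count-neutral helper toward 2′χ
(`--supports stmt-QuantumFields-19936`); registry untouched.  YM₃ on the torus is a RUNG of the programme (UV stability ∕ continuum limit on T³), not the Clay problem: nothing
here is a claim about d = 4, infinite volume, or a mass gap.

References: T. Bałaban, Commun. Math. Phys. 102 (1985) 255–275 [Balaban1985UV3] ((7) p.257, (40)–(42) p.266, (47) p.267, (67)–(68) p.273, Thm 2 p.272); Commun. Math.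
Phys. 102 (1985) 277–309 [Balaban1985Variational] (Thm 1 (6)–(8) pp.278–279); Commun. Math. Phys. 98 (1985) 17–51 [Balaban1985Averaging] (Props. 1–2 p.26).
-/

set_option autoImplicit false

noncomputable section

namespace Summit.QuantumFields.YangMills.Theorems

open MeasureTheory Set
open scoped Matrix.Norms.L2Operator
open Literature.MathematicalPhysics.QuantumFieldTheory.Balaban1983to89
open Literature.MathematicalPhysics.QuantumFieldTheory.Balaban1983to89.T3ContinuumYM3Torus
open Literature.MathematicalPhysics.QuantumFieldTheory.Balaban1983to89.T3UnitScaleTilt (θBal)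
open Literature.MathematicalPhysics.QuantumFieldTheory.Balaban1983to89.T3PrintedMinimiserExistence (Thm1GlobalMinAt)
open Literature.MathematicalPhysics.QuantumFieldTheory.Balaban1983to89.T3Thresholds (sqrt_le_exp_iff)
open Literature.MathematicalPhysics.QuantumFieldTheory.Balaban1983to89.ExpMeanLog (deltaSU)
open Literature.MathematicalPhysics.QuantumFieldTheory.Balaban1985CMP102.Setting
open Summit.QuantumFields.Balaban3D.Carriers
open Summit.QuantumFields.Balaban3D.Proofs.Primitives
open Summit.QuantumFields.Balaban3D.Proofs.Thresholds (Q0 Q0_pos)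
open B7Prop2Explicit (C0 C0_pos)

/-! ## §1 The knits to the χ-socket over the seam-blind class with (D6X) replaced by `7L + 3 ≤ M₁` and its charged half -/

section Knit

variable (F : T3Family) (𝔠 : AlphaConsts F.L (suGroupModel 2).N)

/-- ★★ **THE χ (α) PACKAGE FROM [7] THM 1 + SIZE CONDITIONS (incl. `7L + 3 ≤ M₁`) + (D6X-CHARGED) + THE χ DATA ROWS (O∀χ) OVER `𝒞_X`** — `ofV3ChiAt_of_pinnedRowsXChi` with
`hD6X` supplied by `adaptedClassNonemptyT3X_of_charged_of_collar` ((N2′) ⇐ `collarE_T3_of_M₁_ge`, `4π ≤ C68` ⇐ `four_pi_le_C68_of_sizes`); X4's `ofV3At_of_pinnedRowsXC` in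
χ-currency. [cite: Balaban1985UV3, Thm 2 p.272 + (40)–(42) p.266 + (47) p.267 + (67)–(68) p.273; Balaban1985Variational, Thm 1 (8) p.279] -/
theorem AlphaInputsT3AC.ofV3ChiAt_of_pinnedRowsXCChi {a₀ a₁ : ℝ}
    (hT : Thm1GlobalMinAt F.L a₀ a₁ 𝔠.B₃) (hwin : 𝔠.B₃ * a₁ ≤ a₀)
    (hA3 : (143 * ((((3 + 4 : ℕ) : ℝ)) ^ 2 / 4) ^ 2) * (2 * (𝔠.B₃ * a₁)) ≤ 1 / 3)
    (hA2 : 2 * (2 * (𝔠.B₃ * a₁)) ≤ 2 * deltaSU (Fin 2) / (((3 + 4) * F.L : ℕ) : ℝ) ^ 2)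
    (hB₃ : 1 ≤ 2 * 𝔠.B₃) (hC : 4 * 𝔠.B₃ * (F.L : ℝ) ^ 2 * avgWindowFactor F.L ≤ 𝔠.C68)
    (hanti : (min 𝔠.gamma0 1) ^ 2 ≤ Real.exp (2 * (1 - 𝔠.p₀)))
    (hsmall : ∀ γ : ℝ, 0 < γ → γ ≤ (min 𝔠.gamma0 1) ^ 2 →
      ∀ K k : ℕ, 2 * (F.L : ℝ) ^ 2 * avgWindowFactor F.L * θBal F.L γ 𝔠.b₀ 𝔠.p₀ (K - k + 1) ≤ a₁)
    (hM₁ : 7 * F.L + 3 ≤ 𝔠.M₁)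
    (hD6XC : ∀ (γ : ℝ) (hγ : 0 < γ) (hγ1 : γ ≤ (min 𝔠.gamma0 1) ^ 2) (K : ℕ), AlphaInputsT3AC.AdaptedClassNonemptyChargedT3X F 𝔠 γ hγ hγ1 K)
    (hrows : ∀ (γ : ℝ) (hγ : 0 < γ) (hγ1 : γ ≤ (min 𝔠.gamma0 1) ^ 2) (K : ℕ)
      (Ut : (k : ℕ) → GaugeField (F.P K) k (Matrix.specialUnitaryGroup (Fin 2) ℂ) → GaugeField (F.P K) 0 (Matrix.specialUnitaryGroup (Fin 2) ℂ)),
      AlphaInputsT3AC.TrivMinimiserRowsT3 F 𝔠 γ hγ hγ1 a₀ a₁ K Ut → AlphaInputsT3AC.DataRowsT3XChi F 𝔠 γ hγ hγ1 K Ut) :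
    AlphaInputsT3AC.OfV3ChiAt F 𝔠 a₀ a₁ :=
  AlphaInputsT3AC.ofV3ChiAt_of_pinnedRowsXChi F 𝔠 hT hwin hA3 hA2 hB₃ hC hanti hsmall
    (fun γ hγ hγ1 K => AlphaInputsT3AC.adaptedClassNonemptyT3X_of_charged_of_collar
      (AlphaInputsT3AC.collarE_T3_of_M₁_ge (hγ := hγ) (hγ1 := hγ1) (K := K) hM₁)
      (AlphaInputsT3AC.four_pi_le_C68_of_sizes (𝔠 := 𝔠) hB₃ hC) (hD6XC γ hγ hγ1 K))
    hrows

/-- ★★ **THE SEAM-BLIND χ-SCHEMA FROM [7] THEOREM 1, (D6X-CHARGED), THE PRINT-STRENGTH χ DATA ROW (O″χ), AND SIZES IN CLOSED FORM (incl. `7L + 3 ≤ M₁`)** — X4's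
`dataSchemaT3ACX_of_pinnedRows₂C` in χ-currency (lane A's `dataSchemaT3AC_of_pinnedRows₂` over `𝒞_X`).
[cite: Balaban1985Variational, Thm 1 (6)–(8) pp.278–279; Balaban1985UV3, (40)–(42) p.266, (47) p.267, (68) p.273 and Thm 2 p.272] -/
theorem AlphaInputsT3AC.dataSchemaT3ACXChi_of_pinnedRows₂C {a₀ a₁ : ℝ}
    (hT : Thm1GlobalMinAt F.L a₀ a₁ 𝔠.B₃) (ha₁ : 0 < a₁) (hwin : 𝔠.B₃ * a₁ ≤ a₀)
    (hA3 : (143 * ((((3 + 4 : ℕ) : ℝ)) ^ 2 / 4) ^ 2) * (2 * (𝔠.B₃ * a₁)) ≤ 1 / 3)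
    (hA2 : 2 * (2 * (𝔠.B₃ * a₁)) ≤ 2 * deltaSU (Fin 2) / (((3 + 4) * F.L : ℕ) : ℝ) ^ 2)
    (hB₃ : 1 ≤ 2 * 𝔠.B₃) (hC : 4 * 𝔠.B₃ * (F.L : ℝ) ^ 2 * avgWindowFactor F.L ≤ 𝔠.C68)
    (hCe : Real.exp (𝔠.p₀ - 1) ≤ 3 * C0 3 * 𝔠.C68 * (𝔠.b₀ * Q0 𝔠.p₀))
    (hCa : (𝔠.b₀ * Q0 𝔠.p₀) * (2 * (F.L : ℝ) ^ 2 * avgWindowFactor F.L) ^ 2 ≤ 3 * C0 3 * 𝔠.C68 * a₁ ^ 2)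
    (hM₁ : 7 * F.L + 3 ≤ 𝔠.M₁)
    (hD6XC : ∀ (γ : ℝ) (hγ : 0 < γ) (hγ1 : γ ≤ (min 𝔠.gamma0 1) ^ 2) (K : ℕ), AlphaInputsT3AC.AdaptedClassNonemptyChargedT3X F 𝔠 γ hγ hγ1 K)
    (hrows : ∀ (γ : ℝ) (hγ : 0 < γ) (hγ1 : γ ≤ (min 𝔠.gamma0 1) ^ 2) (K : ℕ),
      (∃ Ut : (k : ℕ) → GaugeField (F.P K) k (Matrix.specialUnitaryGroup (Fin 2) ℂ) → GaugeField (F.P K) 0 (Matrix.specialUnitaryGroup (Fin 2) ℂ),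
        AlphaInputsT3AC.TrivMinimiserRowsT3 F 𝔠 γ hγ hγ1 a₀ a₁ K Ut) →
      ∃ Ut : (k : ℕ) → GaugeField (F.P K) k (Matrix.specialUnitaryGroup (Fin 2) ℂ) → GaugeField (F.P K) 0 (Matrix.specialUnitaryGroup (Fin 2) ℂ),
        AlphaInputsT3AC.TrivMinimiserRowsT3 F 𝔠 γ hγ hγ1 a₀ a₁ K Ut ∧ AlphaInputsT3AC.DataRowsT3XChi F 𝔠 γ hγ hγ1 K Ut) :
    DataSchemaT3ACXChi F 𝔠 a₀ a₁ := by
  have hL1 : 1 ≤ F.L := by have := F.hL.2; omega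
  have hanti := MinimiserPin.anti_of_C68 𝔠 hCe
  have hsmall := MinimiserPin.small_of_C68 𝔠 hL1 ha₁ (avgWindowFactor_pos F) hCa
  have hπ : 4 * Real.pi ≤ 𝔠.C68 := AlphaInputsT3AC.four_pi_le_C68_of_sizes (𝔠 := 𝔠) hB₃ hC
  intro γ hγ hγ1 K
  have hγ1' : γ ≤ 1 := hγ1.trans (sq_min_one_le _ 𝔠.gamma0_pos)
  have hγe : Real.sqrt γ ≤ Real.exp (1 - 𝔠.p₀) := (sqrt_le_exp_iff hγ.le).mpr (hγ1.trans hanti)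
  have hw0 : 0 ≤ (F.L : ℝ) ^ 2 * avgWindowFactor F.L := by
    have := avgWindowFactor_pos F
    positivity
  have hC2 : 2 * (F.L : ℝ) ^ 2 * avgWindowFactor F.L ≤ 𝔠.C68 := by nlinarith
  refine ⟨MinimiserPin.windowIneqT3_of_le F 𝔠 hγ hγ1' hγe hC2 K,
    AlphaInputsT3AC.adaptedClassNonemptyT3X_of_charged_of_collar (AlphaInputsT3AC.collarE_T3_of_M₁_ge (hγ := hγ) (hγ1 := hγ1) (K := K) hM₁) hπ (hD6XC γ hγ hγ1 K),
    hrows γ hγ hγ1 K ?_⟩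
  exact AlphaInputsT3AC.trivMinimiserRowsT3_of_thm1GlobalMinAt F 𝔠 γ hγ hγ1 K hT hwin hA3 hA2 hB₃
    (fun k _ => hsmall γ hγ hγ1 K k)
    (fun k i hik hkK => MinimiserPin.C68_dom_of_le hL1 hγ hγ1' hγe 𝔠.b₀_pos 𝔠.p₀_pos.le (avgWindowFactor_pos F).le
      𝔠.B₃_pos.le hC K k i hik hkK)

/-- ★★ **THE χ (α) PACKAGE FROM THE SAME** (through `ofV3ChiAt_of_dataSchemaT3XChi`); X4's `ofV3At_of_pinnedRows₂XC` in χ-currency.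
[cite: Balaban1985UV3, Thm 2 p.272 + (47) p.267; Balaban1985Variational, Thm 1 (8) p.279] -/
theorem AlphaInputsT3AC.ofV3ChiAt_of_pinnedRows₂XCChi {a₀ a₁ : ℝ}
    (hT : Thm1GlobalMinAt F.L a₀ a₁ 𝔠.B₃) (ha₁ : 0 < a₁) (hwin : 𝔠.B₃ * a₁ ≤ a₀)
    (hA3 : (143 * ((((3 + 4 : ℕ) : ℝ)) ^ 2 / 4) ^ 2) * (2 * (𝔠.B₃ * a₁)) ≤ 1 / 3)
    (hA2 : 2 * (2 * (𝔠.B₃ * a₁)) ≤ 2 * deltaSU (Fin 2) / (((3 + 4) * F.L : ℕ) : ℝ) ^ 2)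
    (hB₃ : 1 ≤ 2 * 𝔠.B₃) (hC : 4 * 𝔠.B₃ * (F.L : ℝ) ^ 2 * avgWindowFactor F.L ≤ 𝔠.C68)
    (hCe : Real.exp (𝔠.p₀ - 1) ≤ 3 * C0 3 * 𝔠.C68 * (𝔠.b₀ * Q0 𝔠.p₀))
    (hCa : (𝔠.b₀ * Q0 𝔠.p₀) * (2 * (F.L : ℝ) ^ 2 * avgWindowFactor F.L) ^ 2 ≤ 3 * C0 3 * 𝔠.C68 * a₁ ^ 2)
    (hM₁ : 7 * F.L + 3 ≤ 𝔠.M₁)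
    (hD6XC : ∀ (γ : ℝ) (hγ : 0 < γ) (hγ1 : γ ≤ (min 𝔠.gamma0 1) ^ 2) (K : ℕ), AlphaInputsT3AC.AdaptedClassNonemptyChargedT3X F 𝔠 γ hγ hγ1 K)
    (hrows : ∀ (γ : ℝ) (hγ : 0 < γ) (hγ1 : γ ≤ (min 𝔠.gamma0 1) ^ 2) (K : ℕ),
      (∃ Ut : (k : ℕ) → GaugeField (F.P K) k (Matrix.specialUnitaryGroup (Fin 2) ℂ) → GaugeField (F.P K) 0 (Matrix.specialUnitaryGroup (Fin 2) ℂ),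
        AlphaInputsT3AC.TrivMinimiserRowsT3 F 𝔠 γ hγ hγ1 a₀ a₁ K Ut) →
      ∃ Ut : (k : ℕ) → GaugeField (F.P K) k (Matrix.specialUnitaryGroup (Fin 2) ℂ) → GaugeField (F.P K) 0 (Matrix.specialUnitaryGroup (Fin 2) ℂ),
        AlphaInputsT3AC.TrivMinimiserRowsT3 F 𝔠 γ hγ hγ1 a₀ a₁ K Ut ∧ AlphaInputsT3AC.DataRowsT3XChi F 𝔠 γ hγ hγ1 K Ut) :
    AlphaInputsT3AC.OfV3ChiAt F 𝔠 a₀ a₁ :=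
  AlphaInputsT3AC.ofV3ChiAt_of_dataSchemaT3XChi
    (AlphaInputsT3AC.dataSchemaT3ACXChi_of_pinnedRows₂C F 𝔠 hT ha₁ hwin hA3 hA2 hB₃ hC hCe hCa hM₁ hD6XC hrows)

end Knit

/-! ## §2 The record-parametric display of 2′χ over the seam-blind class, and the registered 2′χ text from it -/

section Record

/-- **2′χ DISPLAYED OVER THE SEAM-BLIND CLASS** (hypothesis schema, OPEN, never asserted; NAME MAP `PinnedPartsT3ACRecX ↦ PinnedPartsT3ACRecXChi`): X4's
`AlphaInputsT3AC.PinnedPartsT3ACRecX L` VERBATIM with the data row in χ-currency (`DataRowsT3X ↦ DataRowsT3XChi`) — thresholds `(b₁, p₁)`; for every profile beyond them a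
record `𝔠` with exactly that p-function and [7]-constants `a₀, a₁` in print's small-`a₁` regime, the record sizes `1 ≤ 2B₃`, three `C68`-rows, `7L + 3 ≤ M₁` (all free:
`pinnedPartsT3ACRecR_shell`), (T) `Thm1GlobalMinAt`, and per family (D6X-CHARGED) + (O″χ) «the χ data rows hold for some pinned [7]-family whenever one exists».
[cite: Balaban1985UV3, (7) p.257, (40)–(42) p.266, (47) p.267, (68) p.273 and Thm 2 p.272; Balaban1985Variational, Thm 1 (6)–(8) pp.278–279; Balaban1985Averaging, Prop. 2 p.26] -/
def AlphaInputsT3AC.PinnedPartsT3ACRecXChi (L : ℕ) : Prop :=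
  ∃ (b₁ p₁ : ℝ), ∀ (b₀ p₀ : ℝ), b₁ ≤ b₀ → p₁ ≤ p₀ →
    ∃ (𝔠 : AlphaConsts L (suGroupModel 2).N) (a₀ a₁ : ℝ), 𝔠.b₀ = b₀ ∧ 𝔠.p₀ = p₀ ∧ 0 < a₀ ∧ 0 < a₁ ∧ 𝔠.B₃ * a₁ ≤ a₀ ∧
      (143 * ((((3 + 4 : ℕ) : ℝ)) ^ 2 / 4) ^ 2) * (2 * (𝔠.B₃ * a₁)) ≤ 1 / 3 ∧
      2 * (2 * (𝔠.B₃ * a₁)) ≤ 2 * deltaSU (Fin 2) / (((3 + 4) * L : ℕ) : ℝ) ^ 2 ∧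
      1 ≤ 2 * 𝔠.B₃ ∧ 4 * 𝔠.B₃ * (L : ℝ) ^ 2 * avgWindowFactor L ≤ 𝔠.C68 ∧
      Real.exp (𝔠.p₀ - 1) ≤ 3 * C0 3 * 𝔠.C68 * (𝔠.b₀ * Q0 𝔠.p₀) ∧
      (𝔠.b₀ * Q0 𝔠.p₀) * (2 * (L : ℝ) ^ 2 * avgWindowFactor L) ^ 2 ≤ 3 * C0 3 * 𝔠.C68 * a₁ ^ 2 ∧
      7 * L + 3 ≤ 𝔠.M₁ ∧
      Thm1GlobalMinAt L a₀ a₁ 𝔠.B₃ ∧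
      ∀ (F : T3Family) (hF : F.L = L),
        (∀ (γ : ℝ) (hγ : 0 < γ) (hγ1 : γ ≤ (min (hF ▸ 𝔠).gamma0 1) ^ 2) (K : ℕ),
          AlphaInputsT3AC.AdaptedClassNonemptyChargedT3X F (hF ▸ 𝔠) γ hγ hγ1 K) ∧
        (∀ (γ : ℝ) (hγ : 0 < γ) (hγ1 : γ ≤ (min (hF ▸ 𝔠).gamma0 1) ^ 2) (K : ℕ),
          (∃ Ut : (k : ℕ) → GaugeField (F.P K) k (Matrix.specialUnitaryGroup (Fin 2) ℂ) → GaugeField (F.P K) 0 (Matrix.specialUnitaryGroup (Fin 2) ℂ),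
            AlphaInputsT3AC.TrivMinimiserRowsT3 F (hF ▸ 𝔠) γ hγ hγ1 a₀ a₁ K Ut) →
          ∃ Ut : (k : ℕ) → GaugeField (F.P K) k (Matrix.specialUnitaryGroup (Fin 2) ℂ) → GaugeField (F.P K) 0 (Matrix.specialUnitaryGroup (Fin 2) ℂ),
            AlphaInputsT3AC.TrivMinimiserRowsT3 F (hF ▸ 𝔠) γ hγ hγ1 a₀ a₁ K Ut ∧ AlphaInputsT3AC.DataRowsT3XChi F (hF ▸ 𝔠) γ hγ hγ1 K Ut)

/-- At a family of block size `L` the body of `PinnedPartsT3ACRecXChi` gives `OfV3ChiAt` (§1 after transport along `hF`). [cite: Balaban1985UV3, Thm 2 p.272 + (47) p.267; Balaban1985Variational, Thm 1 (8) p.279] -/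
theorem AlphaInputsT3AC.ofV3ChiAt_of_pinnedPartsXChi_cast {L : ℕ} {𝔠 : AlphaConsts L (suGroupModel 2).N} {a₀ a₁ : ℝ}
    (ha₁ : 0 < a₁) (hwin : 𝔠.B₃ * a₁ ≤ a₀)
    (hA3 : (143 * ((((3 + 4 : ℕ) : ℝ)) ^ 2 / 4) ^ 2) * (2 * (𝔠.B₃ * a₁)) ≤ 1 / 3)
    (hA2 : 2 * (2 * (𝔠.B₃ * a₁)) ≤ 2 * deltaSU (Fin 2) / (((3 + 4) * L : ℕ) : ℝ) ^ 2)
    (hB₃ : 1 ≤ 2 * 𝔠.B₃) (hC : 4 * 𝔠.B₃ * (L : ℝ) ^ 2 * avgWindowFactor L ≤ 𝔠.C68)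
    (hCe : Real.exp (𝔠.p₀ - 1) ≤ 3 * C0 3 * 𝔠.C68 * (𝔠.b₀ * Q0 𝔠.p₀))
    (hCa : (𝔠.b₀ * Q0 𝔠.p₀) * (2 * (L : ℝ) ^ 2 * avgWindowFactor L) ^ 2 ≤ 3 * C0 3 * 𝔠.C68 * a₁ ^ 2)
    (hM₁ : 7 * L + 3 ≤ 𝔠.M₁)
    (hT : Thm1GlobalMinAt L a₀ a₁ 𝔠.B₃) (F : T3Family) (hF : F.L = L)
    (hD6XC : ∀ (γ : ℝ) (hγ : 0 < γ) (hγ1 : γ ≤ (min (hF ▸ 𝔠).gamma0 1) ^ 2) (K : ℕ),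
      AlphaInputsT3AC.AdaptedClassNonemptyChargedT3X F (hF ▸ 𝔠) γ hγ hγ1 K)
    (hrows : ∀ (γ : ℝ) (hγ : 0 < γ) (hγ1 : γ ≤ (min (hF ▸ 𝔠).gamma0 1) ^ 2) (K : ℕ),
      (∃ Ut : (k : ℕ) → GaugeField (F.P K) k (Matrix.specialUnitaryGroup (Fin 2) ℂ) → GaugeField (F.P K) 0 (Matrix.specialUnitaryGroup (Fin 2) ℂ),
        AlphaInputsT3AC.TrivMinimiserRowsT3 F (hF ▸ 𝔠) γ hγ hγ1 a₀ a₁ K Ut) →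
      ∃ Ut : (k : ℕ) → GaugeField (F.P K) k (Matrix.specialUnitaryGroup (Fin 2) ℂ) → GaugeField (F.P K) 0 (Matrix.specialUnitaryGroup (Fin 2) ℂ),
        AlphaInputsT3AC.TrivMinimiserRowsT3 F (hF ▸ 𝔠) γ hγ hγ1 a₀ a₁ K Ut ∧ AlphaInputsT3AC.DataRowsT3XChi F (hF ▸ 𝔠) γ hγ hγ1 K Ut) :
    AlphaInputsT3AC.OfV3ChiAt F (hF ▸ 𝔠) a₀ a₁ := by
  subst hF
  exact AlphaInputsT3AC.ofV3ChiAt_of_pinnedRows₂XCChi F 𝔠 hT ha₁ hwin hA3 hA2 hB₃ hC hCe hCa hM₁ hD6XC hrows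

/-- ★★★ **THE SUCCESSOR STUB 2′χ FROM ITS SEAM-BLIND DISPLAY**: `PinnedPartsT3ACRecXChi L → AlphaInputsT3ACv3RecChi L` — 2′χ `stub_laneRecordsV3chi` re-cut to «(T) [7] Thm 1 +
(D6X-CHARGED) + (O″χ) the χ data rows over `𝒞_X`, at a record with exact profile, small `a₁`, `C68 ≥ c_min` and `M₁ ≥ 7L + 3» (X4's `alphaInputsT3ACv3Rec_of_pinnedPartsRecX` in
χ-currency). [cite: Balaban1985UV3, Thm 2 p.272 + (47) p.267; Balaban1985Variational, Thm 1 (8) p.279] -/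
theorem alphaInputsT3ACv3RecChi_of_pinnedPartsRecXChi {L : ℕ} (h : AlphaInputsT3AC.PinnedPartsT3ACRecXChi L) : AlphaInputsT3ACv3RecChi L := by
  obtain ⟨b₁, p₁, h⟩ := h
  refine ⟨b₁, p₁, fun b₀ p₀ hb hp => ?_⟩
  obtain ⟨𝔠, a₀, a₁, h1, h2, h3, h4, h5, hA3, hA2, hB₃, hC, hCe, hCa, hM₁, hT, hD⟩ := h b₀ p₀ hb hp
  exact ⟨𝔠, a₀, a₁, h1, h2, h3, h4, h5, fun F hF =>
    AlphaInputsT3AC.ofV3ChiAt_of_pinnedPartsXChi_cast h4 h5 hA3 hA2 hB₃ hC hCe hCa hM₁ hT F hF (hD F hF).1 (hD F hF).2⟩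

end Record

/-! ## §3 The record-parametric display of 2′χ with (FL), and the registered 2′χ text from it -/

section RecordFL

/-- **2′χ DISPLAYED WITH (FL)** (hypothesis schema, OPEN, never asserted; NAME MAP `PinnedPartsT3ACRecFL ↦ PinnedPartsT3ACRecFLChi`): `…v3RecordFL`'s
`AlphaInputsT3AC.PinnedPartsT3ACRecFL L` VERBATIM with the data row in χ-currency (`DataRowsT3X ↦ DataRowsT3XChi`) = `PinnedPartsT3ACRecXChi` with the kinematic row
(D6X-CHARGED) replaced by **(FL) `InnerFineLiftsT3 … B₃`** (for every admissible non-trivial `(k, h)` and every CHARGED `W`: a finest-lattice field with EXACT `k`-fold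
`blockAvg ℰp`-averages `W` on the bonds of `Ω_k(h)` and every finest plaquette with four corners in `Ω_k(h)` within `B₃·ε_W·L^{−2k}` of `1`; print's `B₃` of Thm 1 (8)) — the
DISPLAY OF RECORD of 2′χ under DEPMAP v3.3. [cite: Balaban1985UV3, (7) p.257, (40)–(42) p.266, (47) p.267, (68) p.273 and Thm 2 p.272; Balaban1985Variational, Thm 1 (6)–(8)
pp.278–279; Balaban1985Averaging, Props. 1–2 p.26] -/
def AlphaInputsT3AC.PinnedPartsT3ACRecFLChi (L : ℕ) : Prop :=
  ∃ (b₁ p₁ : ℝ), ∀ (b₀ p₀ : ℝ), b₁ ≤ b₀ → p₁ ≤ p₀ →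
    ∃ (𝔠 : AlphaConsts L (suGroupModel 2).N) (a₀ a₁ : ℝ), 𝔠.b₀ = b₀ ∧ 𝔠.p₀ = p₀ ∧ 0 < a₀ ∧ 0 < a₁ ∧ 𝔠.B₃ * a₁ ≤ a₀ ∧
      (143 * ((((3 + 4 : ℕ) : ℝ)) ^ 2 / 4) ^ 2) * (2 * (𝔠.B₃ * a₁)) ≤ 1 / 3 ∧
      2 * (2 * (𝔠.B₃ * a₁)) ≤ 2 * deltaSU (Fin 2) / (((3 + 4) * L : ℕ) : ℝ) ^ 2 ∧
      1 ≤ 2 * 𝔠.B₃ ∧ 4 * 𝔠.B₃ * (L : ℝ) ^ 2 * avgWindowFactor L ≤ 𝔠.C68 ∧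
      Real.exp (𝔠.p₀ - 1) ≤ 3 * C0 3 * 𝔠.C68 * (𝔠.b₀ * Q0 𝔠.p₀) ∧
      (𝔠.b₀ * Q0 𝔠.p₀) * (2 * (L : ℝ) ^ 2 * avgWindowFactor L) ^ 2 ≤ 3 * C0 3 * 𝔠.C68 * a₁ ^ 2 ∧
      7 * L + 3 ≤ 𝔠.M₁ ∧
      Thm1GlobalMinAt L a₀ a₁ 𝔠.B₃ ∧
      ∀ (F : T3Family) (hF : F.L = L),
        (∀ (γ : ℝ) (hγ : 0 < γ) (hγ1 : γ ≤ (min (hF ▸ 𝔠).gamma0 1) ^ 2) (K : ℕ),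
          AlphaInputsT3AC.InnerFineLiftsT3 F (hF ▸ 𝔠) γ hγ hγ1 K (hF ▸ 𝔠).B₃) ∧
        (∀ (γ : ℝ) (hγ : 0 < γ) (hγ1 : γ ≤ (min (hF ▸ 𝔠).gamma0 1) ^ 2) (K : ℕ),
          (∃ Ut : (k : ℕ) → GaugeField (F.P K) k (Matrix.specialUnitaryGroup (Fin 2) ℂ) → GaugeField (F.P K) 0 (Matrix.specialUnitaryGroup (Fin 2) ℂ),
            AlphaInputsT3AC.TrivMinimiserRowsT3 F (hF ▸ 𝔠) γ hγ hγ1 a₀ a₁ K Ut) →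
          ∃ Ut : (k : ℕ) → GaugeField (F.P K) k (Matrix.specialUnitaryGroup (Fin 2) ℂ) → GaugeField (F.P K) 0 (Matrix.specialUnitaryGroup (Fin 2) ℂ),
            AlphaInputsT3AC.TrivMinimiserRowsT3 F (hF ▸ 𝔠) γ hγ hγ1 a₀ a₁ K Ut ∧ AlphaInputsT3AC.DataRowsT3XChi F (hF ▸ 𝔠) γ hγ hγ1 K Ut)

/-- **THE (FL)-DISPLAY IMPLIES THE (D6X-CHARGED)-DISPLAY IN χ-CURRENCY** (`PinnedPartsT3ACRecFLChi L → PinnedPartsT3ACRecXChi L`, same record, row by row through the tree's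
`chargedX_of_fineLifts_cast`); `…v3RecordFL`'s `pinnedPartsT3ACRecX_of_recFL` in χ-currency. [cite: Balaban1985UV3, Thm 2 p.272; Balaban1985Variational, Thm 1 (8) p.279] -/
theorem AlphaInputsT3AC.pinnedPartsT3ACRecXChi_of_recFLChi {L : ℕ} (h : AlphaInputsT3AC.PinnedPartsT3ACRecFLChi L) : AlphaInputsT3AC.PinnedPartsT3ACRecXChi L := by
  obtain ⟨b₁, p₁, h⟩ := h
  refine ⟨b₁, p₁, fun b₀ p₀ hb hp => ?_⟩
  obtain ⟨𝔠, a₀, a₁, h1, h2, h3, h4, h5, hA3, hA2, hB₃, hC, hCe, hCa, hM₁, hT, hD⟩ := h b₀ p₀ hb hp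
  exact ⟨𝔠, a₀, a₁, h1, h2, h3, h4, h5, hA3, hA2, hB₃, hC, hCe, hCa, hM₁, hT, fun F hF =>
    ⟨AlphaInputsT3AC.chargedX_of_fineLifts_cast h4 hA3 hA2 hB₃ hC hCe hCa hM₁ F hF (hD F hF).1, (hD F hF).2⟩⟩

/-- ★★★ **THE SUCCESSOR STUB 2′χ FROM ITS (FL)-DISPLAY**: `PinnedPartsT3ACRecFLChi L → AlphaInputsT3ACv3RecChi L` — 2′χ `stub_laneRecordsV3chi` re-cut to «(T) [7] Thm 1 + the
record sizes + **(FL)** (exact `k`-fold (0.4)-lifts of the charged data with regular finest plaquettes under `Ω_k(h)`) + (O″χ) the χ data rows over the seam-blind class `𝒞_X`»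
(`…v3RecordFL`'s `alphaInputsT3ACv3Rec_of_pinnedPartsRecFL` in χ-currency). [cite: Balaban1985UV3, Thm 2 p.272 + (47) p.267; Balaban1985Variational, Thm 1 (8) p.279] -/
theorem alphaInputsT3ACv3RecChi_of_pinnedPartsRecFLChi {L : ℕ} (h : AlphaInputsT3AC.PinnedPartsT3ACRecFLChi L) : AlphaInputsT3ACv3RecChi L :=
  alphaInputsT3ACv3RecChi_of_pinnedPartsRecXChi (AlphaInputsT3AC.pinnedPartsT3ACRecXChi_of_recFLChi h)

end RecordFL

end Summit.QuantumFields.YangMills.Theorems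

end
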